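import Mathlib
import Literature.AlgebraicGeometry.Resolution.DimensionFormula
import Literature.AlgebraicGeometry.Resolution.ExcellentRingsFieldProofs
import Literature.AlgebraicGeometry.Resolution.ExcellentRingsEssFiniteType
import Literature.AlgebraicGeometry.Resolution.RegularLocalRingsProofs
import HarnessLib

/-!
# A local ring with a regular complete-intersection quotient is regular
(`stub_regular_of_regularQuotient_ci`)

Stub of the birth line of the crux `ShadowsUniformize` (route `AbhyankarShadows`).

Setting: `k ⊆ K` fields, `A ⊆ K` a finitely generated `k`-subalgebra, `P` a prime of `A`,
`B = A_P` (a Noetherian local domain, universally catenary as a localization of a finite type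
`k`-algebra), `Q` a prime of `B` with `B ⧸ Q` a regular local ring, and `Q = (S)` generated by a
finset `S` with `#S = ht Q` (a complete intersection).

Claim: `B` is a regular local ring.

Proof: `B` is catenary, so `ht 𝔪_B = ht Q + ht (𝔪_B / Q) = #S + dim (B ⧸ Q)`. Lifting a minimal
system of `dim (B ⧸ Q)` generators of `𝔪_{B/Q}` to `B` and adjoining `S` gives generators of
`𝔪_B` (`𝔪_B = (lifts) + Q`), so `𝔪_B` is generated by `dim (B ⧸ Q) + #S = ht 𝔪_B = dim B`
elements, i.e. `B` is regular (`IsRegularLocalRing.of_spanFinrank_maximalIdeal_le`).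
-/

-- single-problem summit: the doubled namespace component is forced
set_option linter.dupNamespace false

namespace Summit.ResolutionOfSingularities.ResolutionOfSingularities.Theorems

open IsLocalRing Literature.AlgebraicGeometry.Resolution

/-- **Generator count along a quotient.** For a Noetherian local ring `R` and an ideal `I = (S)`
generated by a finset `S` with `R ⧸ I` local: `𝔪_R` needs at most
`(minimal number of generators of 𝔪_{R/I}) + #S` generators — lift a minimal basis of `𝔪_{R/I}`
and adjoin `S`. [folklore] -/
theorem regularQuotientCI_spanFinrank_maximalIdeal_le {R : Type*} [CommRing R] [IsLocalRing R]
    [IsNoetherianRing R] {I : Ideal R} [IsLocalRing (R ⧸ I)] (S : Finset R)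
    (hS : Ideal.span (S : Set R) = I) :
    (maximalIdeal R).spanFinrank ≤ (maximalIdeal (R ⧸ I)).spanFinrank + S.card := by
  classical
  have hIm : I ≤ maximalIdeal R :=
    IsLocalRing.le_maximalIdeal (Ideal.Quotient.nontrivial_iff.mp inferInstance)
  have fg : (maximalIdeal (R ⧸ I)).FG := (isNoetherian_def.mp inferInstance) _
  obtain ⟨t, htcard, htspan⟩ := Submodule.FG.exists_span_finset_card_eq_spanFinrank fg
  -- lift the generators
  let l : R ⧸ I → R := Function.surjInv Ideal.Quotient.mk_surjective
  have hl : ∀ w, Ideal.Quotient.mk I (l w) = w := Function.surjInv_eq Ideal.Quotient.mk_surjective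
  let t' : Finset R := t.image l
  have hmax : maximalIdeal (R ⧸ I) = (maximalIdeal R).map (Ideal.Quotient.mk I) :=
    maximalIdeal_quotient_eq_map I
  have himg : (Ideal.Quotient.mk I) '' (t' : Set R) = (t : Set (R ⧸ I)) := by
    simp only [t', Finset.coe_image, ← Set.image_comp]
    have : (Ideal.Quotient.mk I) ∘ l = id := funext hl
    rw [this, Set.image_id]
  have hspan : maximalIdeal R = Ideal.span ((t' : Set R) ∪ S) := by
    rw [Ideal.span_union, hS]
    apply le_antisymm
    · intro y hy
      have hy' : Ideal.Quotient.mk I y ∈ (Ideal.span (t' : Set R)).map (Ideal.Quotient.mk I) := by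
        rw [Ideal.map_span, himg]
        change _ ∈ Submodule.span (R ⧸ I) (t : Set (R ⧸ I))
        rw [htspan, hmax]
        exact Ideal.mem_map_of_mem _ hy
      rw [← Ideal.mem_comap, Ideal.comap_map_of_surjective _ Ideal.Quotient.mk_surjective,
        ← RingHom.ker_eq_comap_bot, Ideal.mk_ker] at hy'
      exact hy'
    · refine sup_le (Ideal.span_le.mpr fun y hy => ?_) hIm
      simp only [Finset.coe_image, Set.mem_image, Finset.mem_coe, t'] at hy
      obtain ⟨w, hw, rfl⟩ := hy
      have hw' : Ideal.Quotient.mk I (l w) ∈ maximalIdeal (R ⧸ I) := by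
        rw [hl, ← htspan]
        exact Submodule.subset_span hw
      exact (mem_maximalIdeal _).mpr fun hu =>
        (mem_maximalIdeal _).mp hw' (hu.map (Ideal.Quotient.mk I))
  calc (maximalIdeal R).spanFinrank = (Ideal.span ((t' : Set R) ∪ S)).spanFinrank := by
        rw [← hspan]
    _ ≤ ((t' : Set R) ∪ S).ncard :=
        Submodule.spanFinrank_span_le_ncard_of_finite (t'.finite_toSet.union S.finite_toSet)
    _ ≤ (t' : Set R).ncard + (S : Set R).ncard := Set.ncard_union_le _ _
    _ ≤ t.card + S.card := by
        simp only [Set.ncard_coe_finset]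
        exact Nat.add_le_add_right Finset.card_image_le _
    _ = _ := by rw [htcard]

/-- **A local ring of an affine model with a regular complete-intersection quotient is regular.**
For `A ⊆ K` a finitely generated `k`-subalgebra of a field, `P` a prime of `A`, `B = A_P`, and a
prime `Q = (S)` of `B` generated by `#S = ht Q` elements with `B ⧸ Q` regular: `B` is regular.
Indeed `B` is a catenary Noetherian local domain, so `dim B = ht Q + dim (B ⧸ Q)`, and `𝔪_B` is
generated by lifts of `dim (B ⧸ Q)` generators of `𝔪_{B/Q}` together with `S`. [folklore] -/
theorem stub_regular_of_regularQuotient_ci (k K : Type) [Field k] [Field K] [Algebra k K]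
    (A : Subalgebra k K) (hA : A.FG) (P : Ideal A.toSubring) [P.IsPrime]
    (Q : Ideal (Localization.AtPrime P)) [Q.IsPrime]
    (hreg : IsRegularLocalRing (Localization.AtPrime P ⧸ Q)) (S : Finset (Localization.AtPrime P))
    (hS : Ideal.span (S : Set (Localization.AtPrime P)) = Q) (hcard : (S.card : ℕ∞) = Q.height) :
    IsRegularLocalRing (Localization.AtPrime P) := by
  haveI : IsLocalRing (Localization.AtPrime P ⧸ Q) := hreg.toIsLocalRing
  -- `B = A_P` is a Noetherian local domain
  haveI : Algebra.FiniteType k A := A.fg_iff_finiteType.mp hA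
  haveI : IsNoetherianRing A.toSubring := Algebra.FiniteType.isNoetherianRing k A
  haveI : IsNoetherianRing (Localization.AtPrime P) :=
    IsLocalization.isNoetherianRing P.primeCompl _ inferInstance
  -- `B` is catenary: a localization of a finite type algebra over a field
  have hUC : IsUniversallyCatenaryRing A.toSubring :=
    isUniversallyCatenaryRing_of_finiteType_field k A
  have hcat : IsCatenaryRing (Localization.AtPrime P) :=
    (hUC.of_isLocalization (B := Localization.AtPrime P) P.primeCompl).isCatenaryRing
  -- heights: `ht 𝔪_B = ht Q + ht 𝔪_{B/Q}`
  have hQm : Q ≤ maximalIdeal (Localization.AtPrime P) :=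
    IsLocalRing.le_maximalIdeal (Ideal.IsPrime.ne_top ‹_›)
  have hht := IsCatenaryRing.height_eq_height_add_height_map_quotientMk hcat hQm
  have hmax : maximalIdeal (Localization.AtPrime P ⧸ Q) =
      (maximalIdeal (Localization.AtPrime P)).map (Ideal.Quotient.mk Q) :=
    maximalIdeal_quotient_eq_map Q
  rw [← hmax] at hht
  -- `dim (B ⧸ Q) = μ(𝔪_{B/Q})` by regularity
  have hdim := hreg.spanFinrank_maximalIdeal
  rw [← maximalIdeal_height_eq_ringKrullDim] at hdim
  -- generator count
  have hgen := regularQuotientCI_spanFinrank_maximalIdeal_le S hS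
  refine IsRegularLocalRing.of_spanFinrank_maximalIdeal_le _ ?_
  rw [← maximalIdeal_height_eq_ringKrullDim, hht, ← hcard, WithBot.coe_add, ← hdim]
  exact_mod_cast hgen.trans_eq (add_comm _ _)

end Summit.ResolutionOfSingularities.ResolutionOfSingularities.Theorems
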